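import Summits.HubbardSuperconductivity.HubbardSuperconductivity.Theorems.AnisotropyChordTransferFibre3KernelDiff2Lemmas

/-!
# Route `AnisotropyChord` / H0 rotor rung: the SUMMED SECOND-DIFFERENCE BOUND `Σ_n |h_r(n+2eₓ) − 2h_r(n+eₓ) + h_r(n)| ≤ (8K₂·H_{⌊N/2⌋} + 3π²)·|r|²`

Ninth file of the periodisation toolkit (memo ROTOR-THEORY-21 §320–§322): the `ℓ¹` norm of the SECOND differences of the torus
kernel symbol `h_r(n) = (1 − Re φ_n(r))/(2ε(n))` grows only logarithmically in the modulus (first differences: linearly,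
`…KernelDiffSum`), which is what upgrades the periodisation rate from `O(|r|²/L)` to `O(|r|² ln L/L²)`:
* ★ `abs_hfun_d2_le` — POINTWISE (three momenta off the origin): `|Δ²h_r(n)| ≤ K₂·ρ/l1(n + eₓ)²`,
  `K₂ = π²/2 + 53π⁴/8 + 6π⁶` (`quotient_diff2_bound` with Jordan's `c = 2/π²`);
* `invl1sq`, `abs_hfun_d2_le_all` (edge cases folded in), `sum_inv_l1_sq_le` (ring count `Σ_{0<|m|∞≤K} 1/l1(m)² ≤ 8H_K`),
  `sum_invl1sq_le` (`Σ_n invl1sq(n) ≤ 8H_{⌊N/2⌋}`);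
* ★★ `sum_abs_hfun_d2_le`: `Σ_n |h_r(n + 2eₓ) − 2h_r(n + eₓ) + h_r(n)| ≤ (8K₂·H_{⌊N/2⌋} + 3π²)·(x² + y²)`.
Prover seat `hubbard-h0-rotor-p2` g2; helper for stmt-19089. WHAT THIS IS NOT: nothing here proves superconductivity in the Hubbard
model (rotor TARGET stays FALSE, g15); elementary estimates for ONE input (periodisation) of HOLE₂ of rung 19089. No sorry, no axioms.
-/

set_option linter.dupNamespace false

noncomputable section

open scoped BigOperators
open Complex Finset

namespace Summit.HubbardSuperconductivity.HubbardSuperconductivity.Theorems.AnisotropyChord.Transfer.Fibre3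

namespace Subsample

variable (N : ℕ) [NeZero N]

/-- ★ **POINTWISE SECOND-DIFFERENCE BOUND** (`λ = 0`, the three momenta `n, n+eₓ, n+2eₓ` off the origin):
`|h_r(n + 2eₓ) − 2h_r(n + eₓ) + h_r(n)| ≤ K₂·ρ/l1(n + eₓ)²`, `K₂ = π²/2 + 53π⁴/8 + 6π⁶`. [folklore] -/
theorem abs_hfun_d2_le (x y : ℤ) {n : Tor N} (hn : n ≠ 0) (hn1 : n + ex N ≠ 0) (hn2 : n + ex N + ex N ≠ 0) :
    |hfun N (((x : ℤ) : ZMod N), ((y : ℤ) : ZMod N)) (n + ex N + ex N)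
        - 2 * hfun N (((x : ℤ) : ZMod N), ((y : ℤ) : ZMod N)) (n + ex N)
        + hfun N (((x : ℤ) : ZMod N), ((y : ℤ) : ZMod N)) n|
      ≤ (Real.pi ^ 2 / 2 + 53 * Real.pi ^ 4 / 8 + 6 * Real.pi ^ 6)
        * (((x : ℝ) ^ 2 + (y : ℝ) ^ 2) / l1 N (n + ex N) ^ 2) := by
  have hN : (0 : ℝ) < N := by exact_mod_cast Nat.pos_of_ne_zero (NeZero.ne N)
  have e0 : hfun N (((x : ℤ) : ZMod N), ((y : ℤ) : ZMod N)) n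
      = (1 - (phase N n (((x : ℤ) : ZMod N), ((y : ℤ) : ZMod N))).re) * (1 / (2 * epsT N n)) := by
    rw [hfun_eq N hn]; exact div_eq_mul_one_div _ _
  have e1 : hfun N (((x : ℤ) : ZMod N), ((y : ℤ) : ZMod N)) (n + ex N)
      = (1 - (phase N (n + ex N) (((x : ℤ) : ZMod N), ((y : ℤ) : ZMod N))).re) * (1 / (2 * epsT N (n + ex N))) := by
    rw [hfun_eq N hn1]; exact div_eq_mul_one_div _ _
  have e2 : hfun N (((x : ℤ) : ZMod N), ((y : ℤ) : ZMod N)) (n + ex N + ex N)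
      = (1 - (phase N (n + ex N + ex N) (((x : ℤ) : ZMod N), ((y : ℤ) : ZMod N))).re)
        * (1 / (2 * epsT N (n + ex N + ex N))) := by
    rw [hfun_eq N hn2]; exact div_eq_mul_one_div _ _
  rw [e0, e1, e2]
  have hK : (1 / (2 / Real.pi ^ 2) + 53 / (2 * (2 / Real.pi ^ 2) ^ 2) + 48 / (2 / Real.pi ^ 2) ^ 3)
      = Real.pi ^ 2 / 2 + 53 * Real.pi ^ 4 / 8 + 6 * Real.pi ^ 6 := by
    field_simp
    ring
  rw [← hK]
  obtain ⟨hu10, hu1⟩ := u_bounds N (n + ex N) x y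
  have hv0 := two_epsT_ge_l1 N n
  have hv1 := two_epsT_ge_l1 N (n + ex N)
  have hv2 := two_epsT_ge_l1 N (n + ex N + ex N)
  have hdv0 := abs_dv_le N n
  have hdv1 := abs_dv_le N (n + ex N)
  rw [abs_sub_comm] at hdv0 hdv1
  have hd2v := abs_d2v_le N n
  obtain ⟨hw1', hdw0, hdw1, hd2w⟩ := recip_diff_bounds (T := (2 * Real.pi / N) ^ 2) (c := 2 / Real.pi ^ 2)
    (by positivity) (by positivity) (one_le_l1 N hn) (one_le_l1 N hn1) (one_le_l1 N hn2) hv0 hv1 hv2 hdv0 hdv1 hd2v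
  have hw1 : 0 ≤ 1 / (2 * epsT N (n + ex N)) := (one_div_pos.mpr (two_epsT_pos N hn1)).le
  exact quotient_diff2_bound (T := (2 * Real.pi / N) ^ 2) (c := 2 / Real.pi ^ 2) (by positivity) (by positivity)
    (one_le_l1 N hn) (one_le_l1 N hn1) (one_le_l1 N hn2) (by positivity) (l1_succ_le N n).2 (l1_succ_le N (n + ex N)).1
    hu10 hu1 (abs_du_le N x y n) (abs_du_le N x y (n + ex N)) (abs_d2u_le N x y n) hw1 hw1' hdw0 hdw1 hd2w

/-! ## Edge cases and the sum -/

/-- `1/l1(n)²` off the origin, `0` at the origin. [folklore] -/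
def invl1sq (n : Tor N) : ℝ := if n = 0 then 0 else 1 / l1 N n ^ 2

omit [NeZero N] in
/-- `invl1sq ≥ 0`. [folklore] -/
theorem invl1sq_nonneg (n : Tor N) : 0 ≤ invl1sq N n := by
  unfold invl1sq; split_ifs
  · exact le_rfl
  · exact div_nonneg zero_le_one (sq_nonneg _)

/-- pointwise, with the edge cases folded in:
`|Δ²h_r(n)| ≤ K₂ρ·invl1sq(n + eₓ) + π²ρ·([n = 0] + [n + eₓ = 0] + [n + 2eₓ = 0])`. [folklore] -/
theorem abs_hfun_d2_le_all (x y : ℤ) (n : Tor N) :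
    |hfun N (((x : ℤ) : ZMod N), ((y : ℤ) : ZMod N)) (n + ex N + ex N)
        - 2 * hfun N (((x : ℤ) : ZMod N), ((y : ℤ) : ZMod N)) (n + ex N)
        + hfun N (((x : ℤ) : ZMod N), ((y : ℤ) : ZMod N)) n|
      ≤ (Real.pi ^ 2 / 2 + 53 * Real.pi ^ 4 / 8 + 6 * Real.pi ^ 6) * ((x : ℝ) ^ 2 + (y : ℝ) ^ 2) * invl1sq N (n + ex N)
        + Real.pi ^ 2 * ((x : ℝ) ^ 2 + (y : ℝ) ^ 2)
          * ((if n = 0 then (1 : ℝ) else 0) + (if n + ex N = 0 then (1 : ℝ) else 0)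
              + (if n + ex N + ex N = 0 then (1 : ℝ) else 0)) := by
  set r : Tor N := (((x : ℤ) : ZMod N), ((y : ℤ) : ZMod N)) with hr
  have hρ : 0 ≤ (x : ℝ) ^ 2 + (y : ℝ) ^ 2 := by positivity
  have hA : 0 ≤ (Real.pi ^ 2 / 2 + 53 * Real.pi ^ 4 / 8 + 6 * Real.pi ^ 6) * ((x : ℝ) ^ 2 + (y : ℝ) ^ 2)
      * invl1sq N (n + ex N) := mul_nonneg (by positivity) (invl1sq_nonneg N _)
  have hB : 0 ≤ Real.pi ^ 2 * ((x : ℝ) ^ 2 + (y : ℝ) ^ 2) := by positivity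
  have hi0 : 0 ≤ (if n = 0 then (1 : ℝ) else 0) := by split_ifs <;> norm_num
  have hi1 : 0 ≤ (if n + ex N = 0 then (1 : ℝ) else 0) := by split_ifs <;> norm_num
  have hi2 : 0 ≤ (if n + ex N + ex N = 0 then (1 : ℝ) else 0) := by split_ifs <;> norm_num
  -- crude bound on each value: `|h(m)| ≤ π²ρ/4` (also at the origin)
  have hval : ∀ m : Tor N, |hfun N r m| ≤ Real.pi ^ 2 / 4 * ((x : ℝ) ^ 2 + (y : ℝ) ^ 2) := by
    intro m
    by_cases hm : m = 0
    · rw [hm, hfun_zero, abs_zero]; positivity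
    · obtain ⟨h0, h1⟩ := hfun_le N x y hm
      rw [hr, abs_of_nonneg h0]; exact h1
  have hcrude : |hfun N r (n + ex N + ex N) - 2 * hfun N r (n + ex N) + hfun N r n|
      ≤ Real.pi ^ 2 * ((x : ℝ) ^ 2 + (y : ℝ) ^ 2) := by
    have h2 := hval (n + ex N + ex N)
    have h1 := hval (n + ex N)
    have h0 := hval n
    calc _ ≤ |hfun N r (n + ex N + ex N) - 2 * hfun N r (n + ex N)| + |hfun N r n| := abs_add_le _ _
      _ ≤ (|hfun N r (n + ex N + ex N)| + |2 * hfun N r (n + ex N)|) + |hfun N r n| :=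
          add_le_add (abs_sub _ _) le_rfl
      _ ≤ _ := by rw [abs_mul, abs_two]; linarith
  by_cases h0 : n = 0
  · rw [if_pos h0]
    nlinarith [hcrude, mul_nonneg hB hi1, mul_nonneg hB hi2]
  by_cases h1 : n + ex N = 0
  · rw [if_pos h1]
    nlinarith [hcrude, mul_nonneg hB hi0, mul_nonneg hB hi2]
  by_cases h2 : n + ex N + ex N = 0
  · rw [if_pos h2]
    nlinarith [hcrude, mul_nonneg hB hi0, mul_nonneg hB hi1]
  rw [if_neg h0, if_neg h1, if_neg h2, add_zero, add_zero, mul_zero, add_zero]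
  have h := abs_hfun_d2_le N x y h0 h1 h2
  unfold invl1sq
  rw [if_neg h1]
  calc _ ≤ _ := h
    _ = _ := by ring

omit [NeZero N] in
/-- ★ `Σ_{puncturedBox K} 1/l1(m)² ≤ 8·H_K` (each ring has `8j` points of `ℓ¹` norm `≥ j`). [folklore] -/
theorem sum_inv_l1_sq_le (K : ℕ) :
    (∑ m ∈ RateLemma.puncturedBox K, 1 / (|(m.1 : ℝ)| + |(m.2 : ℝ)|) ^ 2) ≤ 8 * (harmonic K : ℝ) := by
  induction K with
  | zero =>
    have : RateLemma.puncturedBox 0 = ∅ := by decide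
    simp [this]
  | succ K ih =>
    rw [← Finset.sum_sdiff (RateLemma.puncturedBox_mono K), harmonic_succ]
    have hring : (∑ m ∈ RateLemma.puncturedBox (K + 1) \ RateLemma.puncturedBox K, 1 / (|(m.1 : ℝ)| + |(m.2 : ℝ)|) ^ 2)
        ≤ 8 / ((K : ℝ) + 1) := by
      have hK1 : (0 : ℝ) < (K : ℝ) + 1 := by positivity
      have hle : ∀ m ∈ RateLemma.puncturedBox (K + 1) \ RateLemma.puncturedBox K,
          1 / (|(m.1 : ℝ)| + |(m.2 : ℝ)|) ^ 2 ≤ 1 / ((K : ℝ) + 1) ^ 2 := fun m hm =>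
        one_div_le_one_div_of_le (by positivity) (pow_le_pow_left₀ hK1.le (ring_l1_ge K m hm) 2)
      have hcard : ((RateLemma.puncturedBox (K + 1) \ RateLemma.puncturedBox K).card : ℝ) = 8 * ((K : ℝ) + 1) := by
        rw [Finset.card_sdiff_of_subset (RateLemma.puncturedBox_mono K), RateLemma.card_puncturedBox,
          RateLemma.card_puncturedBox,
          show 4 * (K + 1) * (K + 1 + 1) = 8 * (K + 1) + 4 * K * (K + 1) by ring, Nat.add_sub_cancel]
        push_cast
        ring
      have h := Finset.sum_le_card_nsmul _ _ _ hle
      rw [nsmul_eq_mul, hcard] at h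
      calc _ ≤ 8 * ((K : ℝ) + 1) * (1 / ((K : ℝ) + 1) ^ 2) := h
        _ = 8 / ((K : ℝ) + 1) := by field_simp
    push_cast
    rw [div_eq_mul_inv] at hring
    linarith

/-- ★ `Σ_n invl1sq(n) ≤ 8·H_{⌊N/2⌋}` (representatives inject into the punctured box of half-width `⌊N/2⌋`). [folklore] -/
theorem sum_invl1sq_le : ∑ n : Tor N, invl1sq N n ≤ 8 * (harmonic (N / 2) : ℝ) := by
  classical
  have hsplit : ∑ n : Tor N, invl1sq N n = ∑ n ∈ Finset.univ.filter (fun n : Tor N => n ≠ 0), 1 / l1 N n ^ 2 := by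
    rw [Finset.sum_filter]
    refine Finset.sum_congr rfl fun n _ => ?_
    unfold invl1sq
    by_cases h : n = 0 <;> simp [h]
  rw [hsplit]
  set rep : Tor N → ℤ × ℤ := fun k => (k.1.valMinAbs, k.2.valMinAbs) with hrep
  have hinj : Set.InjOn rep (Finset.univ.filter (fun n : Tor N => n ≠ 0) : Set (Tor N)) :=
    fun a _ b _ h => RateLemma.rep_injective N h
  have himg : (Finset.univ.filter (fun n : Tor N => n ≠ 0)).image rep ⊆ RateLemma.puncturedBox (N / 2) := by
    intro m hm
    rw [Finset.mem_image] at hm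
    obtain ⟨n, hn, rfl⟩ := hm
    rw [Finset.mem_filter] at hn
    unfold RateLemma.puncturedBox
    rw [Finset.mem_erase]
    refine ⟨?_, RateLemma.rep_mem_box N n⟩
    intro h
    apply hn.2
    simp only [hrep, Prod.mk.injEq] at h
    exact Prod.ext ((ZMod.valMinAbs_eq_zero _).mp h.1) ((ZMod.valMinAbs_eq_zero _).mp h.2)
  have hsum : ∑ n ∈ Finset.univ.filter (fun n : Tor N => n ≠ 0), 1 / l1 N n ^ 2
      = ∑ m ∈ (Finset.univ.filter (fun n : Tor N => n ≠ 0)).image rep, 1 / (|(m.1 : ℝ)| + |(m.2 : ℝ)|) ^ 2 := by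
    rw [Finset.sum_image hinj]
    rfl
  rw [hsum]
  calc _ ≤ ∑ m ∈ RateLemma.puncturedBox (N / 2), 1 / (|(m.1 : ℝ)| + |(m.2 : ℝ)|) ^ 2 :=
        Finset.sum_le_sum_of_subset_of_nonneg himg fun m _ _ => by positivity
    _ ≤ 8 * (harmonic (N / 2) : ℝ) := sum_inv_l1_sq_le (N / 2)

/-- ★★ **THE SUMMED SECOND-DIFFERENCE BOUND** (`λ = 0`):
`Σ_n |h_r(n + 2eₓ) − 2h_r(n + eₓ) + h_r(n)| ≤ (8K₂·H_{⌊N/2⌋} + 3π²)·(x² + y²)`, `K₂ = π²/2 + 53π⁴/8 + 6π⁶`. [folklore] -/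
theorem sum_abs_hfun_d2_le (x y : ℤ) :
    ∑ n : Tor N, |hfun N (((x : ℤ) : ZMod N), ((y : ℤ) : ZMod N)) (n + ex N + ex N)
        - 2 * hfun N (((x : ℤ) : ZMod N), ((y : ℤ) : ZMod N)) (n + ex N)
        + hfun N (((x : ℤ) : ZMod N), ((y : ℤ) : ZMod N)) n|
      ≤ (8 * (Real.pi ^ 2 / 2 + 53 * Real.pi ^ 4 / 8 + 6 * Real.pi ^ 6) * (harmonic (N / 2) : ℝ) + 3 * Real.pi ^ 2)
        * ((x : ℝ) ^ 2 + (y : ℝ) ^ 2) := by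
  classical
  refine (Finset.sum_le_sum fun n _ => abs_hfun_d2_le_all N x y n).trans ?_
  rw [Finset.sum_add_distrib, ← Finset.mul_sum, ← Finset.mul_sum, Finset.sum_add_distrib, Finset.sum_add_distrib]
  have h1 : ∑ n : Tor N, invl1sq N (n + ex N) ≤ 8 * (harmonic (N / 2) : ℝ) := by
    have hc := Equiv.sum_comp (Equiv.addRight (ex N)) (invl1sq N)
    simp only [Equiv.coe_addRight] at hc
    rw [hc]
    exact sum_invl1sq_le N
  have i0 : ∑ n : Tor N, (if n = 0 then (1 : ℝ) else 0) = 1 := by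
    rw [Finset.sum_ite_eq' Finset.univ (0 : Tor N) (fun _ => (1 : ℝ))]; simp
  have i1 : ∑ n : Tor N, (if n + ex N = 0 then (1 : ℝ) else 0) = 1 := by
    have : ∀ n : Tor N, (n + ex N = 0) ↔ (n = -ex N) := fun n => by
      constructor
      · intro h; exact eq_neg_of_add_eq_zero_left h
      · intro h; rw [h, neg_add_cancel]
    simp_rw [this]
    rw [Finset.sum_ite_eq' Finset.univ (-ex N) (fun _ => (1 : ℝ))]; simp
  have i2 : ∑ n : Tor N, (if n + ex N + ex N = 0 then (1 : ℝ) else 0) = 1 := by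
    have : ∀ n : Tor N, (n + ex N + ex N = 0) ↔ (n = -(ex N + ex N)) := fun n => by
      rw [add_assoc]
      constructor
      · intro h; exact eq_neg_of_add_eq_zero_left h
      · intro h; rw [h, neg_add_cancel]
    simp_rw [this]
    rw [Finset.sum_ite_eq' Finset.univ (-(ex N + ex N)) (fun _ => (1 : ℝ))]; simp
  rw [i0, i1, i2]
  have hρ : 0 ≤ (x : ℝ) ^ 2 + (y : ℝ) ^ 2 := by positivity
  have hK : 0 ≤ (Real.pi ^ 2 / 2 + 53 * Real.pi ^ 4 / 8 + 6 * Real.pi ^ 6) * ((x : ℝ) ^ 2 + (y : ℝ) ^ 2) := by positivity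
  nlinarith [mul_le_mul_of_nonneg_left h1 hK]

end Subsample

end Summit.HubbardSuperconductivity.HubbardSuperconductivity.Theorems.AnisotropyChord.Transfer.Fibre3

end
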